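import Literature.NumberTheory.LFunctions.WeilTwoPrimeDeflM72Base
import Literature.NumberTheory.LFunctions.WeilTwoPrimeDeflM72DataR
import Literature.NumberTheory.LFunctions.WeilTwoPrimeCellsT120
import Literature.NumberTheory.LFunctions.WeilTwoPrimeCertificateDeflated
import HarnessLib

/-!
# Deflated two-prime certificate M72: the certificate `weilCertDeflM72 : WeilCert23` and its augmented coefficient matrix

`weilCertDeflM72` = base `weilCertDeflM72Base` + `j = 5` + `pnu = 64` + the cells `weilTwoPrimeCellsT120` + support `b = 18/25` + the table `weilCertDeflM72Nu`; penalty data `weilCertDeflM72R`; `weilCertDeflM72P = P_r + Σ μ ĉ ĉᵀ`. [cite: Yoshida1992, §6, Thm 1 p. 310] Data only.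
-/

noncomputable section

namespace Literature.NumberTheory.LFunctions

/-- **The deflated two-prime certificate M72** (`a₀ = b = 18/25`, `N = 255`, `T = 120`, `β₂₃ = 17/25`, k_odd = 6). [folklore] -/
def weilCertDeflM72 : WeilCert23 := ⟨weilCertDeflM72Base, 5, 64, weilTwoPrimeCellsT120, 18/25, weilCertDeflM72Nu⟩

/-- The base of `weilCertDeflM72` is `weilCertDeflM72Base` (definitional). [folklore] -/
theorem weilCertDeflM72_base : weilCertDeflM72.base = weilCertDeflM72Base := rfl

/-- The table of `weilCertDeflM72` is `weilCertDeflM72Nu` (definitional). [folklore] -/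
theorem weilCertDeflM72_nuTab : weilCertDeflM72.nuTab = weilCertDeflM72Nu := rfl

/-- The augmented coefficient matrix `P_r + Σ μ ĉ ĉᵀ` of certificate M72. [folklore] -/
def weilCertDeflM72P (k l : ℕ) : ℚ := weilCertDeflM72Base.prQ weilCertDeflM72Nu k l + rankOneQ weilCertDeflM72R k l

/-- `weilCertDeflM72P` is the augmented matrix of the certificate (definitional). [folklore] -/
theorem weilCertDeflM72P_eq : weilCertDeflM72P = fun k l ↦ weilCertDeflM72.base.prQ weilCertDeflM72.nuTab k l + rankOneQ weilCertDeflM72R k l := rfl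

end Literature.NumberTheory.LFunctions
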